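import Mathlib
import Summits.NavierStokesRegularity.NavierStokesRegularity.Theorems.EulerZoomLiouvillePowerGaugeEulerLiouvilleSelfSimilarHighSetFlux
import HarnessLib

/-!
# «QUIET BANDS» — the LATERAL EXIT LAW: far out, the similarity flow crosses the Bernoulli level bands only where it is slow
# (crux `EulerZoomLiouville.PowerGaugeEulerLiouville` = stmt-NavierStokesRegularity-19832, THE ONE STATEMENT `stub_selfSimilarC2Needle`, faces T2/T5;
#  line `needle_faces` stub B; width seat ns-ezl-w1 g5)

Route №10 `EulerZoomLiouville` (NavierStokesRegularity).  Sequel of `…SelfSimilarHighSetFlux{Tools}`: there the LATERAL term `∫(θ_out − θ_in)·Dω[W] ≤ 0`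
of the shell identity was dropped (turning law).  Here it is KEPT.  For the Bernoulli weight `ω = S((ℋ_P − h)/η)` (`S = Real.smoothTransition`) one has
EXACTLY `Dω[W] = S′((ℋ−h)/η) · η⁻¹ · (2γ−1)|W|²` (CIV (3.31), `fderiv_bernoulliWeight_transport_eq`), so with
`Λ₁₂ := ((1−2γ)/η) ∫ (θ_out − θ_in) S′((ℋ−h)/η) |W|²  ≥ 0` — the `S′`-average over the levels `t ∈ (h, h+η)` of the `W`-FLUX THROUGH THE LEVEL
SURFACE `{ℋ = t}` between the two layers (coarea; `W·∇ℋ = (2γ−1)|W|²` is the crossing rate) —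

* **`lateral_exit_identity`** — `Λ₁₂ = 3γ ∫ ω(θ_out − θ_in) − (F_out(ω) − F_in(ω))`;
* **`lateral_exit_law`** (Fatou along the fat outer layers `θ_{n,n/2}`, `0 ≤ γ < ½`, `A`-growth `θ_A < 2`, far high set of finite volume):
  `((1−2γ)/η) ∫ (1 − θ_{R,r}) S′((ℋ−h)/η) |W|² ≤ 3γ·vol({ℋ > h} ∩ {R(R−r) ≤ |x|²}) + F_{R,r}(ω)`
  (stated with `∫⁻`: the finiteness of the left side is part of the conclusion) — it CONTAINS the turning law (`Λ ≥ 0`) and says more: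
* **`quiet_band`** — `∫_{|x| ≥ R} S′((ℋ−h)/η) |W|² dx ≤ (η/(1−2γ)) · (3γ·vol({ℋ>h} ∩ {R(R−r) ≤ |x|²}) + F_{R,r}(ω))`:
  THE `|W|²`-MASS OF EVERY BERNOULLI LEVEL BAND `{h < ℋ < h+η}` BEYOND RADIUS `R` IS `≲ η × (thin volume + net outflow flux)`.  With the fat layer
  `r = R/2` the right side tends to `0` (`abs_flux_le`: `|F_{R,R/2}| → 0`; growth-free Sobolev thinness: `vol ≲ R^{−3−3ρ}`): far out, the similarity
  flow crosses the level sets of `ℋ` only where `W` is QUIET (`|W|` small in `L²` on the band), i.e. the far high set is almost invariant in BOTH time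
  directions.

READING FOR THE NEEDLE (RESIDUE-MEMO-19832-g12 §4 (A1)/(A2), §6 T5 «hovering», ezl-w2's residence clocks): a vortical blob fed backward into the far high
set through a fast jet must, forward in time, LEAVE the high set laterally at rate `(1−2γ)|W|²` per unit `ℋ` — the quiet-bands law caps the total
`S′`-weighted `|W|²` available for that beyond radius `R` by `η·(3γ·vol + F_{R,r})`; parked / hovering cells (`W ≈ 0` on the band) are exactly what the
budget allows, transversal fast crossings are not.  Divergence theorem on `{ℋ > t} ∩ {|x| > R}` in boundary-free form:
`(lateral flux out) = 3γ·vol + (radial flux in through S_R) − (flux at ∞ = 0)`.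

HONEST LABEL: tool / portrait inequality; nothing here excludes a needle.  WHAT THIS IS NOT: not NS, not E — `--supports` stmt-19832 on the MODEL
lattice; 19832 OPEN; NS regularity NOT proved. [folklore; ConstantinIgnatovaVicol2026Putative §3.4.1 (3.22), §3.4.3 (3.31)/(3.33); Leray1934 §6 (1.11)]
-/

noncomputable section

-- flat `Theorems/<Route><Decl>…` files of one crux share the namespace of the crux (tree convention)
set_option linter.dupNamespace false

open MeasureTheory Set Filter Topology Metric Function InnerProductSpace
open scoped RealInnerProductSpace NNReal ENNReal

namespace Summit.NavierStokesRegularity.NavierStokesRegularity.Theorems.PowerGaugeEulerLiouville.HighSetFlux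

open Literature.Analysis Literature.Analysis.FluidPDE

variable {γ : ℝ} {U : EuclideanSpace ℝ (Fin 3) → EuclideanSpace ℝ (Fin 3)} {P : EuclideanSpace ℝ (Fin 3) → ℝ}

/-- **The exact derivative of the Bernoulli weight along the transport field** (CIV (3.31)):
`D(S((ℋ−h)/η))[W](x) = S′((ℋ x − h)/η) · η⁻¹ · (2γ−1)‖W x‖²`. [cite: ConstantinIgnatovaVicol2026Putative, §3.4.3 eq. (3.31)] -/
theorem fderiv_bernoulliWeight_transport_eq (hprof : IsSelfSimilarEulerProfile γ 0 U P) (h : ℝ) {η : ℝ} (x : EuclideanSpace ℝ (Fin 3)) :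
    fderiv ℝ (fun x => Real.smoothTransition ((selfSimilarBernoulli γ 0 U P x - h) / η)) x (selfSimilarTransport γ 0 U x) =
      deriv Real.smoothTransition ((selfSimilarBernoulli γ 0 U P x - h) / η) *
        (η⁻¹ * ((2 * γ - 1) * ‖selfSimilarTransport γ 0 U x‖ ^ 2)) := by
  set H : EuclideanSpace ℝ (Fin 3) → ℝ := selfSimilarBernoulli γ 0 U P with hHdef
  have hH1 : ContDiff ℝ 1 H := hprof.contDiff_selfSimilarBernoulli
  have hg : HasFDerivAt (fun x => (H x - h) / η) (η⁻¹ • fderiv ℝ H x) x := by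
    have h1 : HasFDerivAt (fun x => H x - h) (fderiv ℝ H x) x := ((hH1.differentiable one_ne_zero) x).hasFDerivAt.sub_const h
    have h2 := h1.const_mul η⁻¹
    refine (h2.congr_fderiv rfl).congr_of_eventuallyEq (Eventually.of_forall fun y => ?_)
    show (H y - h) / η = η⁻¹ * (H y - h)
    rw [div_eq_inv_mul]
  have hS : HasDerivAt Real.smoothTransition (deriv Real.smoothTransition ((H x - h) / η)) ((H x - h) / η) :=
    ((Real.smoothTransition.contDiff (n := 1)).differentiable one_ne_zero _).hasDerivAt
  have hcomp : HasFDerivAt (fun x => Real.smoothTransition ((H x - h) / η))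
      (deriv Real.smoothTransition ((H x - h) / η) • η⁻¹ • fderiv ℝ H x) x := by
    have := hS.comp_hasFDerivAt x hg
    exact this
  rw [hcomp.fderiv]
  simp only [_root_.smul_apply, smul_eq_mul]
  rw [hprof.fderiv_selfSimilarBernoulli_transport x]

/-- **THE LATERAL EXIT IDENTITY.**  For a `C²` self-similar Euler profile (centre `0`), a level `h`, `η ≠ 0`, the Bernoulli weight `ω = S((ℋ−h)/η)` and
nested Tao cutoffs `θ_in = θ_{R₁,r₁} ≤ θ_out = θ_{R₂,r₂}` (`R₁ ≤ R₂ − r₂`):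
`((1−2γ)/η) ∫ (θ_out − θ_in) S′((ℋ−h)/η) ‖W‖² = 3γ ∫ ω(θ_out − θ_in) − (F_out(ω) − F_in(ω))`, `F_{R,r}(ω) = ∫ ω·(−Dθ_{R,r}[W])`
— the lateral exit of the high set between the layers equals `3γ ×` its mass there minus the net gain of outward flux.
[cite: ConstantinIgnatovaVicol2026Putative, §3.4.1 (3.22), §3.4.3 (3.31)] -/
theorem lateral_exit_identity (hprof : IsSelfSimilarEulerProfile γ 0 U P) (h : ℝ) {η : ℝ} (hη : η ≠ 0)
    {R₁ r₁ R₂ r₂ : ℝ} (hr₁ : 0 < r₁) (hr₁R : r₁ ≤ R₁) (hr₂ : 0 < r₂) (hr₂R : r₂ ≤ R₂) (hnest : R₁ ≤ R₂ - r₂) :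
    (1 - 2 * γ) / η * ∫ x, (taoCutoff R₂ r₂ x - taoCutoff R₁ r₁ x) *
        (deriv Real.smoothTransition ((selfSimilarBernoulli γ 0 U P x - h) / η) * ‖selfSimilarTransport γ 0 U x‖ ^ 2) =
      3 * γ * (∫ x, Real.smoothTransition ((selfSimilarBernoulli γ 0 U P x - h) / η) * (taoCutoff R₂ r₂ x - taoCutoff R₁ r₁ x)) -
        ((∫ x, Real.smoothTransition ((selfSimilarBernoulli γ 0 U P x - h) / η) *
            -(fderiv ℝ (taoCutoff R₂ r₂) x (selfSimilarTransport γ 0 U x))) -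
          ∫ x, Real.smoothTransition ((selfSimilarBernoulli γ 0 U P x - h) / η) *
            -(fderiv ℝ (taoCutoff R₁ r₁) x (selfSimilarTransport γ 0 U x))) := by
  have hid := flux_shell_identity hprof (contDiff_bernoulliWeight hprof h (η := η)) hr₁ hr₁R hr₂ hr₂R hnest
  have hlat : (∫ x, (taoCutoff R₂ r₂ x - taoCutoff R₁ r₁ x) *
      fderiv ℝ (fun x => Real.smoothTransition ((selfSimilarBernoulli γ 0 U P x - h) / η)) x (selfSimilarTransport γ 0 U x)) =
      (2 * γ - 1) / η * ∫ x, (taoCutoff R₂ r₂ x - taoCutoff R₁ r₁ x) *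
        (deriv Real.smoothTransition ((selfSimilarBernoulli γ 0 U P x - h) / η) * ‖selfSimilarTransport γ 0 U x‖ ^ 2) := by
    rw [← integral_const_mul]
    refine integral_congr_ae (Eventually.of_forall fun x => ?_)
    show (taoCutoff R₂ r₂ x - taoCutoff R₁ r₁ x) *
        fderiv ℝ (fun x => Real.smoothTransition ((selfSimilarBernoulli γ 0 U P x - h) / η)) x (selfSimilarTransport γ 0 U x) =
      (2 * γ - 1) / η * ((taoCutoff R₂ r₂ x - taoCutoff R₁ r₁ x) *
        (deriv Real.smoothTransition ((selfSimilarBernoulli γ 0 U P x - h) / η) * ‖selfSimilarTransport γ 0 U x‖ ^ 2))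
    rw [fderiv_bernoulliWeight_transport_eq hprof h x]
    field_simp
  rw [hlat] at hid
  have e : (1 - 2 * γ) / η = -((2 * γ - 1) / η) := by ring
  rw [e]
  linarith

/-- The lateral integrand `(θ_out − θ_in) S′((ℋ−h)/η)‖W‖²` is continuous with compact support (inside `B̄_{R₂}`), hence integrable. [folklore] -/
theorem integrable_lateral (hprof : IsSelfSimilarEulerProfile γ 0 U P) (h η : ℝ) {R₁ r₁ R₂ r₂ : ℝ} (hr₁ : 0 < r₁) (hr₁R : r₁ ≤ R₁)
    (hr₂ : 0 < r₂) (hr₂R : r₂ ≤ R₂) :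
    Integrable fun x => (taoCutoff R₂ r₂ x - taoCutoff R₁ r₁ x) *
      (deriv Real.smoothTransition ((selfSimilarBernoulli γ 0 U P x - h) / η) * ‖selfSimilarTransport γ 0 U x‖ ^ 2) := by
  have hR₁ : 0 < R₁ := hr₁.trans_le hr₁R
  have hR₂ : 0 < R₂ := hr₂.trans_le hr₂R
  have hHc : Continuous (selfSimilarBernoulli γ 0 U P) := hprof.contDiff_selfSimilarBernoulli.continuous
  have hWc : Continuous (selfSimilarTransport γ 0 U) :=
    (((continuous_id.sub continuous_const).const_smul γ).add hprof.contDiff_velocity.continuous :)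
  have hS'c : Continuous (deriv Real.smoothTransition) := (Real.smoothTransition.contDiff (n := 1)).continuous_deriv le_rfl
  have hc : Continuous fun x => (taoCutoff R₂ r₂ x - taoCutoff R₁ r₁ x) *
      (deriv Real.smoothTransition ((selfSimilarBernoulli γ 0 U P x - h) / η) * ‖selfSimilarTransport γ 0 U x‖ ^ 2) :=
    ((continuous_taoCutoff R₂ r₂).sub (continuous_taoCutoff R₁ r₁)).mul
      ((hS'c.comp ((hHc.sub continuous_const).div_const η)).mul (hWc.norm.pow 2))
  refine hc.integrable_of_hasCompactSupport
    (HasCompactSupport.of_support_subset_isCompact (isCompact_closedBall (0 : EuclideanSpace ℝ (Fin 3)) (max R₁ R₂)) fun x hx => ?_)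
  rw [mem_closedBall, dist_zero_right]
  by_contra hxR
  refine hx ?_
  have h2 : max R₁ R₂ < ‖x‖ := not_le.1 hxR
  simp only [taoCutoff_eq_zero hR₂.le hr₂.le ((le_max_right _ _).trans h2.le),
    taoCutoff_eq_zero hR₁.le hr₁.le ((le_max_left _ _).trans h2.le), sub_zero, zero_mul]

/-- **THE OUTER FLUX TENDS TO ZERO** (packaged form of the estimate inside `flux_turning_law`): for `0 ≤ ω ≤ 1` continuous with a far `ω`-set of finite
volume and the `A`-growth `∫_{B̄_L}‖U‖² ≤ c_A L^{θ_A}` (`θ_A < 2`), the flux through the fat layers `θ_{n,n/2}` satisfies `|F_{n,n/2}(ω)| ≤ ε_n` with `ε_n → 0`.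
[folklore] -/
theorem exists_outer_flux_bound {ω : EuclideanSpace ℝ (Fin 3) → ℝ} (hωc : Continuous ω) (hω0 : ∀ x, 0 ≤ ω x) (hω1 : ∀ x, ω x ≤ 1)
    (hU : Continuous U) {cA θA : ℝ} (hθA : θA < 2)
    (hA : ∀ L : ℝ, 1 ≤ L → ∫ x in closedBall (0 : EuclideanSpace ℝ (Fin 3)) L, ‖U x‖ ^ 2 ≤ cA * L ^ θA)
    {R₀ : ℝ} (hfin : volume ({x : EuclideanSpace ℝ (Fin 3) | ω x ≠ 0} ∩ {x | R₀ ≤ ‖x‖ ^ 2}) < ∞) :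
    ∃ ε : ℕ → ℝ, Tendsto ε atTop (𝓝 0) ∧ ∀ n : ℕ, R₀ ≤ (n : ℝ) ^ 2 / 2 → 1 ≤ (n : ℝ) →
      |∫ x, ω x * -(fderiv ℝ (taoCutoff n (n / 2)) x (selfSimilarTransport γ 0 U x))| ≤ ε n := by
  obtain ⟨M, hM0, hM⟩ := exists_abs_deriv_smoothTransition_le
  set S : Set (EuclideanSpace ℝ (Fin 3)) := {x | ω x ≠ 0} ∩ {x | R₀ ≤ ‖x‖ ^ 2} with hSdef
  have hSm : MeasurableSet S :=
    (isOpen_ne_fun hωc continuous_const).measurableSet.inter (isClosed_le continuous_const (continuous_norm.pow 2)).measurableSet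
  set vn : ℕ → ℝ := fun n => (volume (S ∩ {x : EuclideanSpace ℝ (Fin 3) | (n : ℝ) ^ 2 / 2 ≤ ‖x‖ ^ 2})).toReal with hvn
  set ε : ℕ → ℝ := fun n => 4 * M * (vn n / 2 + γ ^ 2 * vn n + cA * (n : ℝ) ^ (θA - 2)) with hεdef
  have hvn0 : Tendsto vn atTop (𝓝 0) := tendsto_volume_inter_far_zero hSm hfin
  have hpow : Tendsto (fun n : ℕ => (n : ℝ) ^ (θA - 2)) atTop (𝓝 0) := by
    have h := (tendsto_rpow_neg_atTop (by linarith : 0 < 2 - θA)).comp tendsto_natCast_atTop_atTop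
    refine h.congr fun n => ?_
    simp only [Function.comp, neg_sub]
  have hε : Tendsto ε atTop (𝓝 0) := by
    have h := ((hvn0.div_const 2).add (hvn0.const_mul (γ ^ 2))).add (hpow.const_mul cA)
    have h' := h.const_mul (4 * M)
    simp only [zero_div, mul_zero, add_zero] at h'
    exact h'
  refine ⟨ε, hε, fun n hnR hn1 => ?_⟩
  have hn : (0 : ℝ) < n := by linarith
  have hr₂ : (0 : ℝ) < n / 2 := by linarith
  have hr₂R : (n : ℝ) / 2 ≤ n := by linarith
  have hout := abs_flux_le (γ := γ) hωc hω0 hω1 hU hr₂ hr₂R hM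
  set An : Set (EuclideanSpace ℝ (Fin 3)) := {x | (n : ℝ) * (n - n / 2) ≤ ‖x‖ ^ 2 ∧ ‖x‖ ≤ n} ∩ {x | ω x ≠ 0} with hAn
  have hAnsub : An ⊆ S ∩ {x : EuclideanSpace ℝ (Fin 3) | (n : ℝ) ^ 2 / 2 ≤ ‖x‖ ^ 2} := by
    intro x hx
    have h1 : (n : ℝ) ^ 2 / 2 ≤ ‖x‖ ^ 2 := by have := hx.1.1; nlinarith
    exact ⟨⟨hx.2, le_trans hnR h1⟩, h1⟩
  have hTfin : volume (S ∩ {x : EuclideanSpace ℝ (Fin 3) | (n : ℝ) ^ 2 / 2 ≤ ‖x‖ ^ 2}) ≠ ∞ :=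
    ((measure_mono inter_subset_left).trans_lt hfin).ne
  have hvAn : (volume An).toReal ≤ vn n := ENNReal.toReal_mono hTfin (measure_mono hAnsub)
  have hIU : (∫ x in closedBall (0 : EuclideanSpace ℝ (Fin 3)) n, ‖U x‖ ^ 2) ≤ cA * (n : ℝ) ^ θA := hA n hn1
  refine hout.trans ?_
  have hcoef : 2 * M / ((n : ℝ) / 2 * n) = 4 * M / (n : ℝ) ^ 2 := by field_simp; ring
  rw [hcoef]
  have hpow' : (n : ℝ) ^ (θA - 2) = (n : ℝ) ^ θA / (n : ℝ) ^ 2 := by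
    rw [Real.rpow_sub hn, Real.rpow_two]
  have hn2' : (0 : ℝ) < (n : ℝ) ^ 2 := by positivity
  rw [hεdef]
  simp only
  rw [hpow', div_mul_eq_mul_div, div_le_iff₀ hn2']
  have h1 : (n : ℝ) ^ 2 / 2 * (volume An).toReal ≤ (n : ℝ) ^ 2 / 2 * vn n :=
    mul_le_mul_of_nonneg_left hvAn (by positivity)
  have h2 : γ ^ 2 * (n : ℝ) ^ 2 * (volume An).toReal ≤ γ ^ 2 * (n : ℝ) ^ 2 * vn n :=
    mul_le_mul_of_nonneg_left hvAn (by positivity)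
  have h3 : 4 * M * (vn n / 2 + γ ^ 2 * vn n + cA * ((n : ℝ) ^ θA / (n : ℝ) ^ 2)) * (n : ℝ) ^ 2 =
      4 * M * ((n : ℝ) ^ 2 / 2 * vn n + γ ^ 2 * (n : ℝ) ^ 2 * vn n + cA * (n : ℝ) ^ θA) := by
    field_simp
  rw [h3]
  exact mul_le_mul_of_nonneg_left (by linarith) (by positivity)

/-- **THE LATERAL EXIT LAW («QUIET BANDS»).**  Let `(U, P)` be a `C²` self-similar Euler profile on `ℝ³` (centre `0`, `0 ≤ γ < ½`) with the
`A`-growth `∫_{B̄_L}‖U‖² ≤ c_A L^{θ_A}` (`L ≥ 1`, `θ_A < 2`); `h` a level whose far high set `{ℋ_P > h} ∩ {R(R−r) ≤ |x|²}` has finite volume `v`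
(`0 < r ≤ R`), `η > 0`, `ω = S((ℋ−h)/η)`, `F_{R,r}(ω) = ∫ ω·(−Dθ_{R,r}[W])` the smeared outward flux of the high set through the layer.  Then

  `∫ (1 − θ_{R,r}) · S′((ℋ−h)/η) · ‖W‖² ≤ (η/(1−2γ)) · (3γ·v + F_{R,r}(ω))`

(as a `∫⁻`-inequality: finiteness of the left side is part of the statement).  Proof: `lateral_exit_identity` against the fat outer layers `θ_{n,n/2}`,
`|F_{n,n/2}| ≤ ε_n → 0` (`exists_outer_flux_bound`), and Fatou.  Since the left side is `≥ 0` this contains the turning law `F_{R,r}(ω) ≥ −3γ v`.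
[folklore; ConstantinIgnatovaVicol2026Putative §3.4.1 (3.22), §3.4.3 (3.31)] -/
theorem lateral_exit_law (hprof : IsSelfSimilarEulerProfile γ 0 U P) (hγ0 : 0 ≤ γ) (hγ : γ < 1 / 2)
    {cA θA : ℝ} (hθA : θA < 2)
    (hA : ∀ L : ℝ, 1 ≤ L → ∫ x in closedBall (0 : EuclideanSpace ℝ (Fin 3)) L, ‖U x‖ ^ 2 ≤ cA * L ^ θA)
    (h : ℝ) {η : ℝ} (hη : 0 < η) {R r : ℝ} (hr : 0 < r) (hrR : r ≤ R)
    (hfin : volume ({x : EuclideanSpace ℝ (Fin 3) | h < selfSimilarBernoulli γ 0 U P x} ∩ {x | R * (R - r) ≤ ‖x‖ ^ 2}) < ∞) :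
    ∫⁻ x, ENNReal.ofReal ((1 - taoCutoff R r x) *
        (deriv Real.smoothTransition ((selfSimilarBernoulli γ 0 U P x - h) / η) * ‖selfSimilarTransport γ 0 U x‖ ^ 2)) ≤
      ENNReal.ofReal (η / (1 - 2 * γ) *
        (3 * γ * (volume ({x : EuclideanSpace ℝ (Fin 3) | h < selfSimilarBernoulli γ 0 U P x} ∩ {x | R * (R - r) ≤ ‖x‖ ^ 2})).toReal +
          ∫ x, Real.smoothTransition ((selfSimilarBernoulli γ 0 U P x - h) / η) *
            -(fderiv ℝ (taoCutoff R r) x (selfSimilarTransport γ 0 U x)))) := by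
  set Hf : EuclideanSpace ℝ (Fin 3) → ℝ := selfSimilarBernoulli γ 0 U P with hHdef
  set W : EuclideanSpace ℝ (Fin 3) → EuclideanSpace ℝ (Fin 3) := selfSimilarTransport γ 0 U with hWdef
  set ω : EuclideanSpace ℝ (Fin 3) → ℝ := fun x => Real.smoothTransition ((Hf x - h) / η) with hωdef
  set S : Set (EuclideanSpace ℝ (Fin 3)) := {x | h < Hf x} ∩ {x | R * (R - r) ≤ ‖x‖ ^ 2} with hSdef
  set v : ℝ := (volume S).toReal with hvdef
  set F₁ : ℝ := ∫ x, ω x * -(fderiv ℝ (taoCutoff R r) x (W x)) with hF₁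
  set q : EuclideanSpace ℝ (Fin 3) → ℝ := fun x => deriv Real.smoothTransition ((Hf x - h) / η) * ‖W x‖ ^ 2 with hqdef
  have hR : 0 < R := hr.trans_le hrR
  have h12 : 0 < 1 - 2 * γ := by linarith
  have hUc : Continuous U := hprof.contDiff_velocity.continuous
  have hHc : Continuous Hf := hprof.contDiff_selfSimilarBernoulli.continuous
  have hWc : Continuous W := (((continuous_id.sub continuous_const).const_smul γ).add hUc :)
  have hS'c : Continuous (deriv Real.smoothTransition) := (Real.smoothTransition.contDiff (n := 1)).continuous_deriv le_rfl
  have hqc : Continuous q := (hS'c.comp ((hHc.sub continuous_const).div_const η)).mul (hWc.norm.pow 2)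
  have hq0 : ∀ x, 0 ≤ q x := fun x => mul_nonneg Real.smoothTransition.monotone.deriv_nonneg (sq_nonneg _)
  have hωc : Continuous ω := Real.smoothTransition.continuous.comp ((hHc.sub continuous_const).div_const η)
  have hω0 : ∀ x, 0 ≤ ω x := fun x => Real.smoothTransition.nonneg _
  have hω1 : ∀ x, ω x ≤ 1 := fun x => Real.smoothTransition.le_one _
  -- the far `ω`-set is inside the far high set
  have hsub : {x : EuclideanSpace ℝ (Fin 3) | ω x ≠ 0} ∩ {x | R * (R - r) ≤ ‖x‖ ^ 2} ⊆ S :=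
    inter_subset_inter_left _ (bernoulliWeight_ne_zero_subset h hη)
  have hfinω : volume ({x : EuclideanSpace ℝ (Fin 3) | ω x ≠ 0} ∩ {x | R * (R - r) ≤ ‖x‖ ^ 2}) < ∞ :=
    (measure_mono hsub).trans_lt hfin
  have hvω : (volume ({x : EuclideanSpace ℝ (Fin 3) | ω x ≠ 0} ∩ {x | R * (R - r) ≤ ‖x‖ ^ 2})).toReal ≤ v :=
    ENNReal.toReal_mono hfin.ne (measure_mono hsub)
  -- the outer flux bound
  obtain ⟨ε, hε, hbound⟩ := exists_outer_flux_bound (γ := γ) hωc hω0 hω1 hUc hθA hA hfinω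
  -- the bound for every large `n`
  set B : ℕ → ℝ := fun n => η / (1 - 2 * γ) * (3 * γ * v + ε n + F₁) with hBdef
  set f : ℕ → EuclideanSpace ℝ (Fin 3) → ℝ≥0∞ := fun n x => ENNReal.ofReal ((taoCutoff n (n / 2) x - taoCutoff R r x) * q x) with hfdef
  have hstep : ∀ n : ℕ, 2 * R ≤ (n : ℝ) → 1 ≤ (n : ℝ) → ∫⁻ x, f n x ≤ ENNReal.ofReal (B n) := by
    intro n hn2 hn1
    have hn : (0 : ℝ) < n := by linarith
    have hr₂ : (0 : ℝ) < n / 2 := by linarith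
    have hr₂R : (n : ℝ) / 2 ≤ n := by linarith
    have hnest : R ≤ (n : ℝ) - n / 2 := by linarith
    have hnsq : R * (R - r) ≤ (n : ℝ) ^ 2 / 2 := by nlinarith
    have hid := lateral_exit_identity hprof h hη.ne' hr hrR hr₂ hr₂R hnest
    have hmass := integral_mul_sub_taoCutoff_le hωc hω0 hω1 hr hrR hr₂ hr₂R hfinω
    have hFn := (abs_le.1 (hbound n hnsq hn1)).1
    have hint := integrable_lateral hprof h η hr hrR hr₂ hr₂R
    have hnn : 0 ≤ᵐ[volume] fun x => (taoCutoff (n : ℝ) (n / 2) x - taoCutoff R r x) * q x :=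
      Eventually.of_forall fun x => mul_nonneg (sub_nonneg.2 (taoCutoff_le_taoCutoff hr hrR hr₂ hr₂R hnest x)) (hq0 x)
    have heq : (∫⁻ x, f n x) = ENNReal.ofReal (∫ x, (taoCutoff (n : ℝ) (n / 2) x - taoCutoff R r x) * q x) := by
      rw [hfdef, ofReal_integral_eq_lintegral_ofReal hint hnn]
    rw [heq]
    refine ENNReal.ofReal_le_ofReal ?_
    -- `(1−2γ)/η · I = 3γ M − (Fₙ − F₁)`
    have e' : (1 - 2 * γ) / η * (∫ x, (taoCutoff (n : ℝ) (n / 2) x - taoCutoff R r x) * q x) =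
        3 * γ * (∫ x, ω x * (taoCutoff (n : ℝ) (n / 2) x - taoCutoff R r x)) -
          ((∫ x, ω x * -(fderiv ℝ (taoCutoff (n : ℝ) (n / 2)) x (W x))) - F₁) := hid
    have hI : (∫ x, (taoCutoff (n : ℝ) (n / 2) x - taoCutoff R r x) * q x) =
        η / (1 - 2 * γ) * (3 * γ * (∫ x, ω x * (taoCutoff (n : ℝ) (n / 2) x - taoCutoff R r x)) -
          ((∫ x, ω x * -(fderiv ℝ (taoCutoff (n : ℝ) (n / 2)) x (W x))) - F₁)) := by
      rw [← e']
      field_simp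
    rw [hI, hBdef]
    refine mul_le_mul_of_nonneg_left ?_ (by positivity)
    have hγv : 3 * γ * (∫ x, ω x * (taoCutoff (n : ℝ) (n / 2) x - taoCutoff R r x)) ≤ 3 * γ * v :=
      mul_le_mul_of_nonneg_left (hmass.trans hvω) (by positivity)
    linarith
  -- Fatou along `n → ∞`
  have hfm : ∀ n, Measurable (f n) := fun n =>
    (((continuous_taoCutoff _ _).sub (continuous_taoCutoff R r)).mul hqc).measurable.ennreal_ofReal
  have hlim : ∀ x, Tendsto (fun n => f n x) atTop (𝓝 (ENNReal.ofReal ((1 - taoCutoff R r x) * q x))) := by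
    intro x
    refine tendsto_const_nhds.congr' ?_
    filter_upwards [eventually_ge_atTop ⌈2 * ‖x‖⌉₊, eventually_gt_atTop 0] with n hn hn0
    have hn' : 2 * ‖x‖ ≤ n := (Nat.le_ceil _).trans (Nat.cast_le.2 hn)
    have hnpos : (0 : ℝ) < n := Nat.cast_pos.2 hn0
    have h1 : taoCutoff (n : ℝ) (n / 2) x = 1 :=
      taoCutoff_eq_one_of_norm_le hnpos (by linarith) (by linarith) (by linarith)
    simp only [hfdef, h1]
  have hliminf : ∀ x, liminf (fun n => f n x) atTop = ENNReal.ofReal ((1 - taoCutoff R r x) * q x) := fun x => (hlim x).liminf_eq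
  have hB : Tendsto (fun n => ENNReal.ofReal (B n)) atTop (𝓝 (ENNReal.ofReal (η / (1 - 2 * γ) * (3 * γ * v + F₁)))) := by
    refine ENNReal.tendsto_ofReal ?_
    have := ((tendsto_const_nhds (x := 3 * γ * v)).add hε).add (tendsto_const_nhds (x := F₁))
    have := this.const_mul (η / (1 - 2 * γ))
    simpa using this
  have hev : ∀ᶠ n : ℕ in atTop, (∫⁻ x, f n x) ≤ ENNReal.ofReal (B n) := by
    filter_upwards [eventually_ge_atTop (max ⌈2 * R⌉₊ 1)] with n hn
    have hn1 : 1 ≤ n := (le_max_right _ _).trans hn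
    have hn2 : ⌈2 * R⌉₊ ≤ n := (le_max_left _ _).trans hn
    exact hstep n ((Nat.le_ceil _).trans (Nat.cast_le.2 hn2)) (by exact_mod_cast hn1)
  calc (∫⁻ x, ENNReal.ofReal ((1 - taoCutoff R r x) * q x))
      = ∫⁻ x, liminf (fun n => f n x) atTop := lintegral_congr fun x => (hliminf x).symm
    _ ≤ liminf (fun n => ∫⁻ x, f n x) atTop := lintegral_liminf_le hfm
    _ ≤ liminf (fun n => ENNReal.ofReal (B n)) atTop := liminf_le_liminf hev
    _ = ENNReal.ofReal (η / (1 - 2 * γ) * (3 * γ * v + F₁)) := hB.liminf_eq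

/-- **QUIET BANDS.**  Under the hypotheses of `lateral_exit_law`: the `S′((ℋ−h)/η)`-weighted `‖W‖²`-mass beyond radius `R` is integrable and
`∫_{R ≤ |x|} S′((ℋ−h)/η) ‖W‖² dx ≤ (η/(1−2γ)) · (3γ·vol({ℋ > h} ∩ {R(R−r) ≤ |x|²}) + F_{R,r}(ω))`:
every Bernoulli level band `{h < ℋ < h + η}` beyond `R` carries `|W|²`-mass `≲ η × (thin volume + net outflow flux of the high set through the layer)`.
With the fat layer `r = R/2`, `|F_{R,R/2}(ω)| → 0` (`abs_flux_le`) and the growth-free Sobolev thinness `vol ≲ R^{−3−3ρ}`: far out the similarity flow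
crosses the level sets of `ℋ` only where it is quiet. [folklore; ConstantinIgnatovaVicol2026Putative §3.4.3 (3.31)/(3.33)] -/
theorem quiet_band (hprof : IsSelfSimilarEulerProfile γ 0 U P) (hγ0 : 0 ≤ γ) (hγ : γ < 1 / 2)
    {cA θA : ℝ} (hθA : θA < 2)
    (hA : ∀ L : ℝ, 1 ≤ L → ∫ x in closedBall (0 : EuclideanSpace ℝ (Fin 3)) L, ‖U x‖ ^ 2 ≤ cA * L ^ θA)
    (h : ℝ) {η : ℝ} (hη : 0 < η) {R r : ℝ} (hr : 0 < r) (hrR : r ≤ R)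
    (hfin : volume ({x : EuclideanSpace ℝ (Fin 3) | h < selfSimilarBernoulli γ 0 U P x} ∩ {x | R * (R - r) ≤ ‖x‖ ^ 2}) < ∞) :
    IntegrableOn (fun x => deriv Real.smoothTransition ((selfSimilarBernoulli γ 0 U P x - h) / η) * ‖selfSimilarTransport γ 0 U x‖ ^ 2)
        {x : EuclideanSpace ℝ (Fin 3) | R ≤ ‖x‖} ∧
      ∫ x in {x : EuclideanSpace ℝ (Fin 3) | R ≤ ‖x‖},
          deriv Real.smoothTransition ((selfSimilarBernoulli γ 0 U P x - h) / η) * ‖selfSimilarTransport γ 0 U x‖ ^ 2 ≤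
        η / (1 - 2 * γ) *
          (3 * γ * (volume ({x : EuclideanSpace ℝ (Fin 3) | h < selfSimilarBernoulli γ 0 U P x} ∩ {x | R * (R - r) ≤ ‖x‖ ^ 2})).toReal +
            ∫ x, Real.smoothTransition ((selfSimilarBernoulli γ 0 U P x - h) / η) *
              -(fderiv ℝ (taoCutoff R r) x (selfSimilarTransport γ 0 U x))) := by
  set q : EuclideanSpace ℝ (Fin 3) → ℝ := fun x =>
    deriv Real.smoothTransition ((selfSimilarBernoulli γ 0 U P x - h) / η) * ‖selfSimilarTransport γ 0 U x‖ ^ 2 with hqdef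
  set Bv : ℝ := η / (1 - 2 * γ) *
    (3 * γ * (volume ({x : EuclideanSpace ℝ (Fin 3) | h < selfSimilarBernoulli γ 0 U P x} ∩ {x | R * (R - r) ≤ ‖x‖ ^ 2})).toReal +
      ∫ x, Real.smoothTransition ((selfSimilarBernoulli γ 0 U P x - h) / η) *
        -(fderiv ℝ (taoCutoff R r) x (selfSimilarTransport γ 0 U x))) with hBv
  have hR : 0 < R := hr.trans_le hrR
  have hlaw := lateral_exit_law hprof hγ0 hγ hθA hA h hη hr hrR hfin
  have hHc : Continuous (selfSimilarBernoulli γ 0 U P) := hprof.contDiff_selfSimilarBernoulli.continuous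
  have hWc : Continuous (selfSimilarTransport γ 0 U) :=
    (((continuous_id.sub continuous_const).const_smul γ).add hprof.contDiff_velocity.continuous :)
  have hS'c : Continuous (deriv Real.smoothTransition) := (Real.smoothTransition.contDiff (n := 1)).continuous_deriv le_rfl
  have hqc : Continuous q := (hS'c.comp ((hHc.sub continuous_const).div_const η)).mul (hWc.norm.pow 2)
  have hq0 : ∀ x, 0 ≤ q x := fun x => mul_nonneg Real.smoothTransition.monotone.deriv_nonneg (sq_nonneg _)
  have hAm : MeasurableSet {x : EuclideanSpace ℝ (Fin 3) | R ≤ ‖x‖} := (isClosed_le continuous_const continuous_norm).measurableSet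
  -- on `{R ≤ ‖x‖}` the cutoff vanishes, so the integrand is the one of the law
  have hpt : ∀ x ∈ {x : EuclideanSpace ℝ (Fin 3) | R ≤ ‖x‖}, ENNReal.ofReal (q x) = ENNReal.ofReal ((1 - taoCutoff R r x) * q x) := by
    intro x hx
    rw [taoCutoff_eq_zero hR.le hr.le hx, sub_zero, one_mul]
  have hset : (∫⁻ x in {x : EuclideanSpace ℝ (Fin 3) | R ≤ ‖x‖}, ENNReal.ofReal (q x)) ≤ ENNReal.ofReal Bv := by
    calc (∫⁻ x in {x : EuclideanSpace ℝ (Fin 3) | R ≤ ‖x‖}, ENNReal.ofReal (q x))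
        = ∫⁻ x in {x : EuclideanSpace ℝ (Fin 3) | R ≤ ‖x‖}, ENNReal.ofReal ((1 - taoCutoff R r x) * q x) :=
          setLIntegral_congr_fun hAm hpt
      _ ≤ ∫⁻ x, ENNReal.ofReal ((1 - taoCutoff R r x) * q x) := setLIntegral_le_lintegral _ _
      _ ≤ ENNReal.ofReal Bv := hlaw
  have hint : IntegrableOn q {x : EuclideanSpace ℝ (Fin 3) | R ≤ ‖x‖} := by
    refine ⟨hqc.aestronglyMeasurable.restrict, ?_⟩
    refine (hasFiniteIntegral_iff_ofReal (Eventually.of_forall fun x => hq0 x)).2 ?_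
    exact hset.trans_lt ENNReal.ofReal_lt_top
  refine ⟨hint, ?_⟩
  have hBv0 : (∫ x in {x : EuclideanSpace ℝ (Fin 3) | R ≤ ‖x‖}, q x) ≤ max Bv 0 := by
    rw [integral_eq_lintegral_of_nonneg_ae (Eventually.of_forall fun x => hq0 x) hint.aestronglyMeasurable]
    refine ENNReal.toReal_le_of_le_ofReal (le_max_right _ _) (hset.trans (ENNReal.ofReal_le_ofReal (le_max_left _ _)))
  by_cases hB : 0 ≤ Bv
  · rwa [max_eq_left hB] at hBv0
  · -- `Bv < 0` is impossible: the lintegral bound forces `ofReal Bv ≥ 0 = ∫⁻ ≥ …`; but then the real integral is `≤ 0 ≤`… we argue directly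
    -- `Bv < 0` contradicts the turning law
    exfalso
    have hturn := bernoulli_flux_turning_law hprof hγ0 hγ.le hθA hA h hη hr hrR hfin
    have h12 : 0 < 1 - 2 * γ := by linarith
    have : 0 ≤ Bv := by
      rw [hBv]
      exact mul_nonneg (div_nonneg hη.le h12.le) (by linarith)
    exact hB this

end Summit.NavierStokesRegularity.NavierStokesRegularity.Theorems.PowerGaugeEulerLiouville.HighSetFlux

end
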